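import Summits.MatrixMultiplication.MatrixMultiplication.Theorems.AbelianSTPPSieve
import Summits.MatrixMultiplication.MatrixMultiplication.Theorems.AbelianSTPPCensusShapeCertSearch
import Summits.MatrixMultiplication.MatrixMultiplication.Theorems.AbelianSTPPCensusShapeCertEvalA
import Summits.MatrixMultiplication.MatrixMultiplication.Theorems.AbelianSTPPCensusShapeCertEvalB
import Summits.MatrixMultiplication.MatrixMultiplication.Theorems.AbelianSTPPCensusShapeCertEvalC
import Summits.MatrixMultiplication.MatrixMultiplication.Theorems.AbelianSTPPCensusShapeCertEvalD
import Summits.MatrixMultiplication.MatrixMultiplication.Theorems.AbelianSTPPCensusShapeCertEvalE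
import Summits.MatrixMultiplication.MatrixMultiplication.Theorems.AbelianSTPPCensusShapeCertEvalF
import Summits.MatrixMultiplication.MatrixMultiplication.Theorems.AbelianSTPPCensusShapeCertEvalG
import Summits.MatrixMultiplication.MatrixMultiplication.Theorems.AbelianSTPPCensusShapeCertEvalH
import Summits.MatrixMultiplication.MatrixMultiplication.Theorems.AbelianSTPPCensusShapeCertEvalI

/-!
# Abelian STPP census — crux `ShapeExclusionTE` of route `AbelianSTPPCensus` (cell mm-stpp, rung F-M1), kernel

`shapeExclusionTE_holds`: every shape list with at least two members that satisfies the sieve system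
`SieveAdmissible M` and beats `5/2` at an order `M ≤ 127` has `M ∈ {111,120,121,124,125,126,127}` and contains
one of the registered residual sub-multisets — the statement of the route's crux item `ShapeExclusionTE`
verbatim (lineage B, implementation code-disjoint from the planner's `feas_scan` and the seat's `sieve_b`).
Assembly: the tree statement is transported to the checker's semantics (`GM`, `admM_GM`, `beats_gsum` via the
exact sixth-power gain table `gain_pow_le` and `Real.rpow`, `hasSubShapes_of_le` via an injective choice of
indices), then `ShapeCert.check_sound` and the kernel evaluations `check_le_127` conclude.
-/

set_option linter.dupNamespace false -- `MatrixMultiplication.MatrixMultiplication` (summit = problem, D-0017)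
set_option autoImplicit false

namespace Summit.MatrixMultiplication.MatrixMultiplication.Theorems.ShapeCert

/-- members of a checked range are checked -/
theorem check_of_all {s n M : ℕ} (h : ((List.range' s n).all check) = true) (hs : s ≤ M) (hlt : M < s + n) :
    check M = true :=
  List.all_eq_true.mp h M (List.mem_range'_1.mpr ⟨hs, hlt⟩)

/-- **The certificate holds at every order `M ≤ 127`** (kernel evaluations of the `Eval` files). -/
theorem check_le_127 (M : ℕ) (hM : M ≤ 127) : check M = true := by
  rcases Nat.lt_or_ge M 30 with h0 | h0
  · exact check_of_all checks_0_30 (Nat.zero_le _) (by omega)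
  rcases Nat.lt_or_ge M 40 with h1 | h1
  · exact check_of_all checks_30_40 h0 (by omega)
  rcases Nat.lt_or_ge M 48 with h2 | h2
  · exact check_of_all checks_40_48 h1 (by omega)
  rcases Nat.lt_or_ge M 55 with h3 | h3
  · exact check_of_all checks_48_55 h2 (by omega)
  rcases Nat.lt_or_ge M 61 with h4 | h4
  · exact check_of_all checks_55_61 h3 (by omega)
  rcases Nat.lt_or_ge M 66 with h5 | h5
  · exact check_of_all checks_61_66 h4 (by omega)
  rcases Nat.lt_or_ge M 70 with h6 | h6
  · exact check_of_all checks_66_70 h5 (by omega)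
  interval_cases M
  · exact check_70
  · exact check_71
  · exact check_72
  · exact check_73
  · exact check_74
  · exact check_75
  · exact check_76
  · exact check_77
  · exact check_78
  · exact check_79
  · exact check_80
  · exact check_81
  · exact check_82
  · exact check_83
  · exact check_84
  · exact check_85
  · exact check_86
  · exact check_87
  · exact check_88
  · exact check_89
  · exact check_90
  · exact check_91
  · exact check_92
  · exact check_93
  · exact check_94
  · exact check_95
  · exact check_96
  · exact check_97
  · exact check_98
  · exact check_99
  · exact check_100
  · exact check_101
  · exact check_102
  · exact check_103
  · exact check_104
  · exact check_105
  · exact check_106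
  · exact check_107
  · exact check_108
  · exact check_109
  · exact check_110
  · exact check_111
  · exact check_112
  · exact check_113
  · exact check_114
  · exact check_115
  · exact check_116
  · exact check_117
  · exact check_118
  · exact check_119
  · exact check_120
  · exact check_121
  · exact check_122
  · exact check_123
  · exact check_124
  · exact check_125
  · exact check_126
  · exact check_127

end Summit.MatrixMultiplication.MatrixMultiplication.Theorems.ShapeCert

/-!
# Crux `ShapeExclusionTE` of route `AbelianSTPPCensus`: the bridge from the tree statement to the checker
-/

namespace Summit.MatrixMultiplication.MatrixMultiplication.Theorems.ShapeCert

open Multiset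

section gains
/-! ### Real gains versus integer gains -/

/-- the table inequality `V⁵ · 10³⁶ ≤ gainOf(V)⁶` for `V ≤ 127` -/
theorem gain_pow_le : ∀ V ≤ 127, V ^ 5 * 1000000 ^ 6 ≤ gainOf V ^ 6 := by decide +kernel

/-- `V^{5/6} ≤ gainOf(V)/10⁶` for `V ≤ 127` -/
theorem rpow_le_gain (V : ℕ) (hV : V ≤ 127) :
    ((V : ℕ) : ℝ) ^ ((5 / 2 : ℝ) / 3) ≤ (gainOf V : ℝ) / 1000000 := by
  have h := gain_pow_le V hV
  have hx : (0 : ℝ) ≤ V := Nat.cast_nonneg V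
  have hle : (V : ℝ) ^ 5 ≤ ((gainOf V : ℝ) / 1000000) ^ 6 := by
    rw [div_pow, le_div_iff₀ (by positivity)]
    exact_mod_cast h
  have e1 : ((5 / 2 : ℝ) / 3) = ((5 : ℕ) : ℝ) * ((1 : ℝ) / 6) := by norm_num
  rw [e1, Real.rpow_natCast_mul hx]
  calc ((V : ℝ) ^ 5) ^ ((1 : ℝ) / 6) ≤ (((gainOf V : ℝ) / 1000000) ^ 6) ^ ((1 : ℝ) / 6) :=
        Real.rpow_le_rpow (pow_nonneg hx 5) hle (by norm_num)
    _ = (gainOf V : ℝ) / 1000000 := by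
        rw [show ((1 : ℝ) / 6) = ((6 : ℕ) : ℝ)⁻¹ by norm_num]
        exact Real.pow_rpow_inv_natCast (by positivity) (by norm_num)

end gains

section family
/-! ### The shape multiset of a family of shapes indexed by `Fin N` -/

variable {N M : ℕ} (a b c : Fin N → ℕ)

/-- shape triple of member `i` -/
def shp (i : Fin N) : ℕ × ℕ × ℕ := (a i, b i, c i)

/-- the shape multiset of the family -/
def GM : Multiset (ℕ × ℕ × ℕ) := (Finset.univ : Finset (Fin N)).val.map (shp a b c)

/-- sums over the shape multiset are sums over the members -/
theorem sum_GM (g : ℕ × ℕ × ℕ → ℕ) : ((GM a b c).map g).sum = ∑ i, g (shp a b c i) := by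
  rw [Finset.sum_eq_multiset_sum, GM, Multiset.map_map]; rfl

/-- members of the shape multiset -/
theorem mem_GM {x : ℕ × ℕ × ℕ} : x ∈ GM a b c ↔ ∃ i, shp a b c i = x := by
  unfold GM; simp

/-- erased sums over the shape multiset -/
theorem erase_sum_GM (i : Fin N) (g : ℕ × ℕ × ℕ → ℕ) :
    (((GM a b c).erase (shp a b c i)).map g).sum = ∑ j ∈ Finset.univ.erase i, g (shp a b c j) := by
  have hmem : shp a b c i ∈ GM a b c := (mem_GM a b c).mpr ⟨i, rfl⟩
  have h1 : ((GM a b c).map g).sum = g (shp a b c i) + (((GM a b c).erase (shp a b c i)).map g).sum := by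
    conv_lhs => rw [← Multiset.cons_erase hmem]
    simp
  have h2 : ∑ j, g (shp a b c j) = g (shp a b c i) + ∑ j ∈ Finset.univ.erase i, g (shp a b c j) :=
    (Finset.add_sum_erase _ _ (Finset.mem_univ i)).symm
  rw [sum_GM] at h1; omega

/-- a member of the erased shape multiset comes from another index -/
theorem mem_erase_GM (i : Fin N) {y : ℕ × ℕ × ℕ} (hy : y ∈ (GM a b c).erase (shp a b c i)) :
    ∃ j, j ≠ i ∧ shp a b c j = y := by
  by_cases he : y = shp a b c i
  · subst he
    have hc : 2 ≤ Multiset.count (shp a b c i) (GM a b c) := by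
      have h1 := Multiset.count_pos.mpr hy
      rw [Multiset.count_erase_self] at h1; omega
    unfold GM at hc
    rw [Multiset.count_map] at hc
    have hc' : 1 < (Finset.univ.filter fun j => shp a b c i = shp a b c j).card := by
      rw [Finset.card_def, Finset.filter_val]; omega
    obtain ⟨j₁, hj₁, j₂, hj₂, hne⟩ := Finset.one_lt_card.mp hc'
    rw [Finset.mem_filter] at hj₁ hj₂
    by_cases h1 : j₁ = i
    · subst h1; exact ⟨j₂, hne.symm, hj₂.2.symm⟩
    · exact ⟨j₁, h1, hj₁.2.symm⟩
  · obtain ⟨j, hj⟩ := (mem_GM a b c).mp (Multiset.mem_of_mem_erase hy)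
    exact ⟨j, fun hji => he (by rw [← hj, hji]), hj⟩

/-- the boolean divisor test from the tree's tightness conclusion -/
theorem hasLCD_of {V M f : ℕ} (hV : 1 ≤ V) (h : HasLargeCommonDivisor V M f) : hasLCD V M f = true := by
  obtain ⟨d, hfd, hdV, hdM⟩ := h
  unfold hasLCD; rw [decide_eq_true_eq]
  exact hfd.trans (Nat.le_of_dvd (Nat.gcd_pos_of_pos_left M hV) (Nat.dvd_gcd hdV hdM))

/-- every member of a sieve-admissible family with at least two members lies in the universe -/
theorem inUniv_shp (hN : 2 ≤ N) (hS : SieveAdmissible M a b c) (i : Fin N) : InUniv M (shp a b c i) := by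
  unfold SieveAdmissible at hS; dsimp only at hS
  obtain ⟨h1, hNeu, -, -, h13, -, -⟩ := hS
  obtain ⟨ha, hb, hc, hV⟩ := h1 i
  obtain ⟨n1, n2, n3⟩ := hNeu i
  haveI : Nontrivial (Fin N) := Fin.nontrivial_iff_two_le.mpr hN
  obtain ⟨j, hj⟩ := exists_ne i
  obtain ⟨u1, u2, u3, -, -, -⟩ := h13 i j hj.symm
  unfold InUniv inUnivB shp; simp only [Bool.and_eq_true, decide_eq_true_eq]
  unfold shapeVol at *
  have hm : max (a i) (max (b i) (c i)) ≤ M - a i * b i * c i :=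
    max_le (by omega) (max_le (by omega) (by omega))
  refine ⟨⟨⟨⟨⟨⟨ha, hb⟩, hc⟩, by omega⟩, n1⟩, n2⟩, n3⟩

/-- the hereditary sieve system holds for the shape multiset of a sieve-admissible family -/
theorem admM_GM (hN : 2 ≤ N) (hS : SieveAdmissible M a b c) : AdmM M (GM a b c) := by
  have hU := inUniv_shp a b c hN hS
  unfold SieveAdmissible at hS; dsimp only at hS
  obtain ⟨-, -, h2, h11, h913, h14, hT⟩ := hS
  refine ⟨?_, ?_, ?_, ?_, ?_⟩
  · rw [sum_GM, sum_GM, sum_GM]; exact h2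
  · intro x hx; obtain ⟨i, rfl⟩ := (mem_GM a b c).mp hx
    rw [sum_GM, sum_GM, sum_GM]; exact h11 i
  · intro x hx y hy; obtain ⟨i, rfl⟩ := (mem_GM a b c).mp hx
    obtain ⟨j, hji, rfl⟩ := mem_erase_GM a b c i hy
    obtain ⟨-, -, -, p1, p2, p3⟩ := h913 i j hji.symm
    unfold mpp3 pab pbc pca vol shp; unfold shapeVol at p1 p2 p3
    simp only
    have hm : max (a i * b i) (max (b i * c i) (c i * a i)) ≤ M - a j * b j * c j :=
      max_le (by omega) (max_le (by omega) (by omega))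
    omega
  · intro x hx; obtain ⟨i, rfl⟩ := (mem_GM a b c).mp hx
    obtain ⟨c1, c2, c3, c4, c5, c6⟩ := h14 i
    have hVpos : 1 ≤ vol (shp a b c i) := (hU i).one_le_vol
    rw [erase_sum_GM, erase_sum_GM, erase_sum_GM]
    unfold u14Sum at *
    exact ⟨⟨c1, fun h => hasLCD_of hVpos (c2 h)⟩, ⟨c3, fun h => hasLCD_of hVpos (c4 h)⟩,
      ⟨c5, fun h => hasLCD_of hVpos (c6 h)⟩⟩
  · intro x hx; obtain ⟨i, rfl⟩ := (mem_GM a b c).mp hx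
    obtain ⟨t1, t2, t3⟩ := hT i
    have hVpos : 1 ≤ vol (shp a b c i) := (hU i).one_le_vol
    rw [erase_sum_GM, erase_sum_GM, erase_sum_GM]
    unfold u14Sum at *
    exact ⟨fun p q => hasLCD_of hVpos (t1 p q), fun p q => hasLCD_of hVpos (t2 p q),
      fun p q => hasLCD_of hVpos (t3 p q)⟩

/-- a beating family has integer gain above `10⁶·M` -/
theorem beats_gsum (hS : SieveAdmissible M a b c) (hM : M ≤ 127) (hB : Beats (5 / 2) M a b c) :
    M * D < gsumM (GM a b c) := by
  unfold Beats at hB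
  have hV : ∀ i, shapeVol a b c i ≤ 127 := fun i => by
    unfold SieveAdmissible at hS; dsimp only at hS; exact (hS.1 i).2.2.2.trans hM
  have hsum : (M : ℝ) < ∑ i, ((gainOf (shapeVol a b c i) : ℝ) / 1000000) :=
    hB.trans_le (Finset.sum_le_sum fun i _ => rpow_le_gain _ (hV i))
  rw [← Finset.sum_div, lt_div_iff₀ (by norm_num)] at hsum
  have h2 : M * 1000000 < ∑ i, gainOf (shapeVol a b c i) := by exact_mod_cast hsum
  unfold gsumM D; rw [sum_GM]; exact h2

/-- an injective choice of indices realising a sub-multiset of shapes -/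
theorem exists_emb_of_le {α : Type*} [DecidableEq α] (f : Fin N → α) :
    ∀ (L : List α) (S : Finset (Fin N)), (L : Multiset α) ≤ S.val.map f →
      ∃ φ : Fin L.length ↪ Fin N, (∀ r, φ r ∈ S) ∧ ∀ r, f (φ r) = L.get r
  | [], _, _ => ⟨⟨Fin.elim0, fun i => Fin.elim0 i⟩, fun r => Fin.elim0 r, fun r => Fin.elim0 r⟩
  | x :: L, S, h => by
    have hx : x ∈ S.val.map f := Multiset.mem_of_le h (by simp)
    obtain ⟨i, hi, hfi⟩ := Multiset.mem_map.mp hx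
    have hS : S.val = i ::ₘ (S.erase i).val := by rw [Finset.erase_val, Multiset.cons_erase hi]
    have h' : (L : Multiset α) ≤ (S.erase i).val.map f := by
      have h2 : x ::ₘ (L : Multiset α) ≤ f i ::ₘ (S.erase i).val.map f := by
        rw [← Multiset.map_cons, ← hS]; exact h
      rw [hfi] at h2
      exact (Multiset.cons_le_cons_iff x).mp h2
    obtain ⟨φ, hφS, hφ⟩ := exists_emb_of_le f L (S.erase i) h'
    have hnot : i ∉ Set.range (φ : Fin L.length → Fin N) := by
      rintro ⟨r, hr⟩; have := hφS r; rw [hr] at this; simp at this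
    refine ⟨⟨Fin.cons i φ, Fin.cons_injective_iff.mpr ⟨hnot, φ.injective⟩⟩, ?_, ?_⟩
    · intro r; refine Fin.cases ?_ (fun r => ?_) r
      · simpa using hi
      · simp only [Function.Embedding.coeFn_mk, Fin.cons_succ]; exact Finset.mem_of_mem_erase (hφS r)
    · intro r; refine Fin.cases ?_ (fun r => ?_) r
      · simpa using hfi
      · simp only [Function.Embedding.coeFn_mk, Fin.cons_succ]; exact hφ r

/-- a sub-multiset of the shape multiset is a list of sub-shapes of the family -/
theorem hasSubShapes_of_le {L : List (ℕ × ℕ × ℕ)} (h : (L : Multiset (ℕ × ℕ × ℕ)) ≤ GM a b c) :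
    HasSubShapes a b c L := by
  obtain ⟨φ, -, hφ⟩ := exists_emb_of_le (shp a b c) L Finset.univ h
  exact ⟨φ, fun r => hφ r⟩

end family

/-- the orders and lists of the residual table -/
theorem residLists_mem {M : ℕ} {L : List (ℕ × ℕ × ℕ)} (h : L ∈ residLists M) :
    (M = 111 ∧ L = [(4,4,4), (4,4,4), (4,4,4), (3,3,3)]) ∨
    ((M = 120 ∨ M = 121) ∧ (L = [(4,4,4), (4,4,4), (4,4,4), (4,4,3)] ∨
      L = [(4,4,4), (4,4,4), (4,4,4), (4,3,4)] ∨ L = [(4,4,4), (4,4,4), (4,4,4), (3,4,4)])) ∨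
    (M = 124 ∧ (L = [(5,4,3), (3,4,5), (4,4,4), (4,4,4)] ∨ L = [(5,3,4), (3,5,4), (4,4,4), (4,4,4)] ∨
      L = [(4,5,3), (4,3,5), (4,4,4), (4,4,4)] ∨ L = [(4,4,4), (4,4,4), (4,4,4), (4,4,4)])) ∨
    (M = 125 ∧ (L = [(4,4,4), (4,4,4), (4,4,4), (4,4,4)] ∨ L = [(5,5,3), (5,3,5), (3,5,5), (3,3,3)])) ∨
    ((M = 126 ∨ M = 127) ∧ L = [(4,4,4), (4,4,4), (4,4,4), (4,4,4)]) := by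
  unfold residLists at h; split at h <;> simp_all

end Summit.MatrixMultiplication.MatrixMultiplication.Theorems.ShapeCert

namespace Summit.MatrixMultiplication.MatrixMultiplication.Theorems

open ShapeCert in
/-- **Crux `ShapeExclusionTE` of route `AbelianSTPPCensus` (cell mm-stpp, rung F-M1; lineage B, kernel).**
Every shape list with at least two members that satisfies the sieve system `SieveAdmissible M` and beats `5/2`
at an order `M ≤ 127` has `M ∈ {111, 120, 121, 124, 125, 126, 127}` and contains one of the registered residual
sub-multisets.  Proof: the verified certificate checker `ShapeCert.check` (soundness `ShapeCert.check_sound`)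
evaluated by the kernel at every order `M ≤ 127` (`ShapeCert.check_le_127`). -/
theorem shapeExclusionTE_holds : ∀ (N M : ℕ) (a b c : Fin N → ℕ), 2 ≤ N → M ≤ 127 →
    SieveAdmissible M a b c → Beats (5 / 2) M a b c →
    (M = 111 ∧ HasSubShapes a b c [(4,4,4),(4,4,4),(4,4,4),(3,3,3)]) ∨
    ((M = 120 ∨ M = 121) ∧ (HasSubShapes a b c [(4,4,4),(4,4,4),(4,4,4),(4,4,3)] ∨
      HasSubShapes a b c [(4,4,4),(4,4,4),(4,4,4),(4,3,4)] ∨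
      HasSubShapes a b c [(4,4,4),(4,4,4),(4,4,4),(3,4,4)])) ∨
    (M = 124 ∧ (HasSubShapes a b c [(5,4,3),(3,4,5),(4,4,4),(4,4,4)] ∨
      HasSubShapes a b c [(5,3,4),(3,5,4),(4,4,4),(4,4,4)] ∨
      HasSubShapes a b c [(4,5,3),(4,3,5),(4,4,4),(4,4,4)] ∨
      HasSubShapes a b c [(4,4,4),(4,4,4),(4,4,4),(4,4,4)])) ∨
    (M = 125 ∧ (HasSubShapes a b c [(4,4,4),(4,4,4),(4,4,4),(4,4,4)] ∨
      HasSubShapes a b c [(5,5,3),(5,3,5),(3,5,5),(3,3,3)])) ∨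
    ((M = 126 ∨ M = 127) ∧ HasSubShapes a b c [(4,4,4),(4,4,4),(4,4,4),(4,4,4)]) := by
  intro N M a b c hN hM hS hB
  obtain ⟨L, hL, hle⟩ := check_sound (check_le_127 M hM) (GM a b c)
    (fun x hx => by obtain ⟨i, rfl⟩ := (mem_GM a b c).mp hx; exact inUniv_shp a b c hN hS i)
    (admM_GM a b c hN hS) (beats_gsum a b c hS hM hB)
  have H : ∀ L' : List (ℕ × ℕ × ℕ), (L' : Multiset (ℕ × ℕ × ℕ)) ≤ GM a b c → HasSubShapes a b c L' :=
    fun L' h => hasSubShapes_of_le a b c h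
  rcases residLists_mem hL with ⟨rfl, rfl⟩ | ⟨hM', hL'⟩ | ⟨rfl, hL'⟩ | ⟨rfl, hL'⟩ | ⟨hM', rfl⟩
  · exact Or.inl ⟨rfl, H _ hle⟩
  · refine Or.inr (Or.inl ⟨hM', ?_⟩)
    rcases hL' with rfl | rfl | rfl
    · exact Or.inl (H _ hle)
    · exact Or.inr (Or.inl (H _ hle))
    · exact Or.inr (Or.inr (H _ hle))
  · refine Or.inr (Or.inr (Or.inl ⟨rfl, ?_⟩))
    rcases hL' with rfl | rfl | rfl | rfl
    · exact Or.inl (H _ hle)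
    · exact Or.inr (Or.inl (H _ hle))
    · exact Or.inr (Or.inr (Or.inl (H _ hle)))
    · exact Or.inr (Or.inr (Or.inr (H _ hle)))
  · refine Or.inr (Or.inr (Or.inr (Or.inl ⟨rfl, ?_⟩)))
    rcases hL' with rfl | rfl
    · exact Or.inl (H _ hle)
    · exact Or.inr (H _ hle)
  · exact Or.inr (Or.inr (Or.inr (Or.inr ⟨hM', H _ hle⟩)))

end Summit.MatrixMultiplication.MatrixMultiplication.Theorems
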